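import Summits.BirchSwinnertonDyer.BirchSwinnertonDyer.Theorems.GenusKolyvaginAtTwoGenusPrimitiveSupplyAtTwoPosDiscShallowKFourPosCellCapitulation
import Summits.BirchSwinnertonDyer.BirchSwinnertonDyer.Theorems.GenusKolyvaginAtTwoGenusPrimitiveSupplyAtTwoPrimeTwistRadicalLine
import HarnessLib

/-!
# Route `GenusKolyvaginAtTwo`, crux 25504, K₄⁺ cell (item K4Pos, stmt-BirchSwinnertonDyer-31469) at positive depth:
# THE TRICHOTOMY OF INVARIANT SELMER CLASSES — `0`, THE CAPITULATING CLASS `s_y`, OR A CLASS SURVIVING IN `Ш(E_K/K)[2]`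

Seat `bsd-line-gk2-p5` g35 (cell `bsd-f1-sign2`, WIDTH-5 attach), `--supports stmt-BirchSwinnertonDyer-31469 --as helper`; sequel of p767715
(`…KFourPosCellCapitulation`: the Kummer class of `Q₀ = y_K/2^{M₀}` descends to a unique non-zero `s_y ∈ Sel₂(E/ℚ)`).  THEOREMS ONLY.
**BSD is NOT proved by this file, no item is closed, the registered stub C⁺‴ / item K4Pos are untouched.**

WHY.  On the K₄⁺ cell with `rank E(K) = 1` (the frame's Mordell–Weil rank: `rank E(ℚ) = 0`, the twin has rank `1`) and `E(K)[2] = 0`, the Kummer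
image `κ₂(E(K)) ⊂ Sel₂(E_K/K)` has exactly TWO elements (`GenusKolyArch.exists_kummerMapTorsion_two_generator`, `#E(K)/2E(K) = 2^{rank}·#E(K)[2]`),
namely `0` and `κ₂(Q₀)` (`Q₀ ∉ 2E(K)`).  Hence for a `σ₀`-INVARIANT Selmer class `m = res_K s` of `E_K` (`s ∈ Sel₂(E/ℚ)` unique, p766630):

* `mem_range_kummerMapTorsion_iff_of_kFourPos` — **`m ∈ κ₂(E(K)) ⟺ s = 0 ∨ s = s_y`** (`s_y` = the descent of `κ₂(Q₀)`, p767715);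
* `not_mem_range_kummerMapTorsion_iff_of_kFourPos` — **`m ∉ κ₂(E(K))` (its image `d ∈ H¹(K, E)[2]`, a class of `Ш(E_K/K)[2]`, is NON-ZERO)
  `⟺ s ≠ 0 ∧ s ≠ s_y`**.

READING for K₄⁺ / the LEAD's sharp target: a level-1 deep class `c₁(ℓ) = res_K s(ℓ)` (K₄⁺ port of p767174) falls in exactly one of THREE cases —
`s(ℓ) = 0` (no witness: `P(ℓ) ∈ 2E(K[ℓ])`), `s(ℓ) = s_y` (witness, `P(ℓ) ∉ 2E(K[ℓ])`, but `d(ℓ) = 0`: `P(ℓ) ≡ Q₀` modulo `2E(K[ℓ])`-and-`E(K)`),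
`s(ℓ) ∈ Sel₂(E/ℚ) ∖ {0, s_y}` (witness with `d(ℓ) ≠ 0`: Kolyvagin's class REALISES a non-zero element of `Ш(E_K/K)[2] ≅ (ℤ/2)²`, the event his
structure theorem manufactures when `#Ш(E_K)[2^∞] = 4^{M₀}`).  Nothing here proves K₄⁺ or BSD.

References: [GrossLMS1991] §4 (4.1)–(4.6), §5 (5.1); [McCallumLMS1991] §4 Lemma 4.1–4.3, §5; [Kramer1981] Thm. 1; [SilvermanAEC2009] VIII.§2, X.4.2.
-/

set_option linter.dupNamespace false -- `Summit.<P>.<Sub>` repeats `BirchSwinnertonDyer` (D-0017)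
set_option autoImplicit false

noncomputable section

open scoped Classical NumberField

namespace Summit.BirchSwinnertonDyer.BirchSwinnertonDyer.Theorems.GenusSupplyNarrow.KFourPosCell

open WeierstrassCurve NumberField IsDedekindDomain Field Function
open Literature.NumberTheory.EllipticCurves Literature.NumberTheory.GaloisRepresentations
open Literature.NumberTheory.GaloisCohomology Literature.NumberTheory.EllipticCurves.ModularForms
open Summit.BirchSwinnertonDyer.BirchSwinnertonDyer.Theorems.GenusSupplyNarrow

variable (W : WeierstrassCurve ℚ) [W.IsElliptic] [W.IsGloballyMinimal] (K : Type) [Field K] [NumberField K]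

omit [W.IsGloballyMinimal] in
/-- **At rank one with `E(K)[2] = 0`, the Kummer image is `{0, κ₂(Q₀)}` for ANY `Q₀ ∉ 2E(K)`** (`#κ₂(E(K)) = 2`,
`GenusKolyArch.exists_kummerMapTorsion_two_generator`). [cite: SilvermanAEC2009, VIII.§2, Thm. X.4.2(a)] -/
theorem kummerMapTorsion_eq_zero_or_eq_of_rank_one (hrk : (W.baseChange K).mordellWeilRank = 1)
    (h2K : ∀ T : (W.baseChange K).toAffine.Point, (2 : ℤ) • T = 0 → T = 0)
    {Q₀ : (W.baseChange K).toAffine.Point} (hQ₀ : ¬ ∃ R : (W.baseChange K).toAffine.Point, (2 : ℤ) • R = Q₀)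
    (P : (W.baseChange K).toAffine.Point) :
    kummerMapTorsion (W.baseChange K) ((2 : ℕ) : ℤ) (GenusKolyArch.hdiv_two_baseChange W K) P = 0 ∨
      kummerMapTorsion (W.baseChange K) ((2 : ℕ) : ℤ) (GenusKolyArch.hdiv_two_baseChange W K) P =
        kummerMapTorsion (W.baseChange K) ((2 : ℕ) : ℤ) (GenusKolyArch.hdiv_two_baseChange W K) Q₀ := by
  haveI : (W.baseChange K).IsElliptic := by rw [baseChange]; infer_instance
  have htors : Nat.card (AddSubgroup.torsionBy (W.baseChange K).toAffine.Point ((2 : ℕ) : ℤ)) = 1 := by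
    have hbot : AddSubgroup.torsionBy (W.baseChange K).toAffine.Point ((2 : ℕ) : ℤ) = ⊥ :=
      (AddSubgroup.eq_bot_iff_forall _).mpr fun T hT ↦ h2K T (by
        have h := AddSubgroup.torsionBy.nsmul_iff.mp hT
        rwa [← natCast_zsmul] at h)
    rw [hbot, AddSubgroup.card_bot]
  obtain ⟨P₁, hP₁, hgen⟩ := GenusKolyArch.exists_kummerMapTorsion_two_generator (W.baseChange K) (GenusKolyArch.hdiv_two_baseChange W K) hrk htors
  have hQ₀ne := kummerMapTorsion_ne_zero_of_frame W K hQ₀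
  -- `κ(Q₀) = κ(P₁)`
  have hQP : kummerMapTorsion (W.baseChange K) ((2 : ℕ) : ℤ) (GenusKolyArch.hdiv_two_baseChange W K) Q₀ =
      kummerMapTorsion (W.baseChange K) ((2 : ℕ) : ℤ) (GenusKolyArch.hdiv_two_baseChange W K) P₁ :=
    (hgen Q₀).resolve_left hQ₀ne
  rcases hgen P with h | h
  · exact Or.inl h
  · exact Or.inr (h.trans hQP.symm)

omit [W.IsGloballyMinimal] in
/-- **THE TRICHOTOMY, KUMMER SIDE: `res_K s ∈ κ₂(E(K)) ⟺ s = 0 ∨ s = s_y`.**  K₄⁺ cell (`Δ > 0`, `ρ̄₂` onto, `∏ c(E)` odd, the K₄⁺ clause;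
`K` imaginary quadratic, `d_K` odd, Heegner, `2` split; `Wd = Cd • E^{(d_K)}` with `ord₂ C(Wd) = 0`; `τ ≠ 1`), `rank E(K) = 1`; `P ∈ E(K)` Heegner,
`w(E) = +1`, `2^M Q₀ = P`, `Q₀ ∉ 2E(K)`; `s_y` the descent of `κ₂(Q₀)` (`res_K s_y = κ₂(Q₀)`, p767715).  For every `s ∈ H¹(ℚ, E[2])`:
`res_K s` is a Kummer class over `K` iff `s ∈ {0, s_y}` (`res_K` injective, Kummer image `= {0, κ₂(Q₀)}`).
[cite: Kramer1981, Thm. 1] [cite: GrossLMS1991, §5 (5.1)] [cite: SilvermanAEC2009, Thm. X.4.2(a)] -/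
theorem resTorsion_mem_range_kummerMapTorsion_iff_of_kFourPos (hs2 : W.HasSurjectiveModNGaloisRep 2)
    (hK : IsImaginaryQuadratic K) (hrk : (W.baseChange K).mordellWeilRank = 1)
    {Q₀ : (W.baseChange K).toAffine.Point} (hQ₀ : ¬ ∃ R : (W.baseChange K).toAffine.Point, (2 : ℤ) • R = Q₀)
    {s_y : galH1Torsion W ((2 : ℕ) : ℤ)}
    (hsy : resTorsion W K ((2 : ℕ) : ℤ) s_y = kummerMapTorsion (W.baseChange K) ((2 : ℕ) : ℤ) (GenusKolyArch.hdiv_two_baseChange W K) Q₀)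
    (s : galH1Torsion W ((2 : ℕ) : ℤ)) :
    resTorsion W K ((2 : ℕ) : ℤ) s ∈ (kummerMapTorsion (W.baseChange K) ((2 : ℕ) : ℤ) (GenusKolyArch.hdiv_two_baseChange W K)).range ↔
      s = 0 ∨ s = s_y := by
  have h2 : Module.finrank ℚ K = 2 := hK.1
  have hL := forall_two_smul_eq_zero_baseChange_of_kFourPos W K hs2 h2
  have h2K : ∀ T : (W.baseChange K).toAffine.Point, (2 : ℤ) • T = 0 → T = 0 := fun T hT ↦ hL T (by simpa using hT)
  obtain ⟨θ, hθ, hc⟩ := Literature.NumberTheory.EllipticCurves.exists_sq_eq_discr_not_mem_range K h2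
  have hinj := GenusExact.EigenClassesFinite.resTorsion_injective_of_noTorsion W K h2 hθ hc ((2 : ℕ) : ℤ) hL
  constructor
  · rintro ⟨P, hP⟩
    rcases kummerMapTorsion_eq_zero_or_eq_of_rank_one W K hrk h2K hQ₀ P with h | h
    · left
      apply hinj
      rw [map_zero, ← hP, h]
    · right
      apply hinj
      rw [hsy, ← hP, h]
  · rintro (rfl | rfl)
    · exact ⟨0, by rw [map_zero, map_zero]⟩
    · exact ⟨Q₀, hsy.symm⟩

omit [W.IsGloballyMinimal] in
/-- **THE TRICHOTOMY, Ш SIDE: a `σ₀`-invariant Selmer class of `E_K` leaves the Kummer image — i.e. gives a NON-ZERO class of `Ш(E_K/K)[2]` —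
iff its descent `s ∈ Sel₂(E/ℚ)` is neither `0` nor the capitulating class `s_y`.**  Same frame.  READING for a deep class `c₁(ℓ) = res_K s(ℓ)`
(K₄⁺ port of p767174): `s(ℓ) = 0` no witness; `s(ℓ) = s_y` witness with `d(ℓ) = 0`; otherwise witness with `d(ℓ) ≠ 0`.
[cite: Kramer1981, Thm. 1] [cite: GrossLMS1991, §4 (4.5)–(4.6), §5 (5.1)] [cite: McCallumLMS1991, §4 Lemma 4.2] -/
theorem resTorsion_not_mem_range_kummerMapTorsion_iff_of_kFourPos (hs2 : W.HasSurjectiveModNGaloisRep 2)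
    (hK : IsImaginaryQuadratic K) (hrk : (W.baseChange K).mordellWeilRank = 1)
    {Q₀ : (W.baseChange K).toAffine.Point} (hQ₀ : ¬ ∃ R : (W.baseChange K).toAffine.Point, (2 : ℤ) • R = Q₀)
    {s_y : galH1Torsion W ((2 : ℕ) : ℤ)}
    (hsy : resTorsion W K ((2 : ℕ) : ℤ) s_y = kummerMapTorsion (W.baseChange K) ((2 : ℕ) : ℤ) (GenusKolyArch.hdiv_two_baseChange W K) Q₀)
    (s : galH1Torsion W ((2 : ℕ) : ℤ)) :
    resTorsion W K ((2 : ℕ) : ℤ) s ∉ (kummerMapTorsion (W.baseChange K) ((2 : ℕ) : ℤ) (GenusKolyArch.hdiv_two_baseChange W K)).range ↔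
      s ≠ 0 ∧ s ≠ s_y := by
  rw [resTorsion_mem_range_kummerMapTorsion_iff_of_kFourPos W K hs2 hK hrk hQ₀ hsy s, not_or]

/-- **THE TRICHOTOMY IN THE CRUXES' CURRENCY** (K₄⁺ cell of 25504 at McCallum's exponent, `rank E(K) = 1` from the frame): with `P₀, Q₀ ∈ E(K)`,
`2^{M₀}Q₀ = P₀ ↦ P(1)`, `Q₀ ∉ 2E(K)` and the capitulating class `s_y` of p767715 `existsUnique_resTorsion_eq_kummer_of_depth_pos`, EVERY
`σ₀`-invariant class `m ∈ Sel₂(E_K/K)` descends to a unique `s ∈ Sel₂(E/ℚ)` (p766630) and: `m ∈ κ₂(E(K)) ⟺ s ∈ {0, s_y}`.  So the invariant part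
`Sel₂(E_K)^{σ₀} = res_K Sel₂(E/ℚ)` (four classes) meets the Kummer image in exactly `{0, κ₂(Q₀)}`, and the other two invariant classes map
injectively to `Ш(E_K/K)[2]`.  UNCONDITIONAL.  BSD is NOT proved by this. [cite: Kramer1981, Thm. 1] [cite: GrossLMS1991, §5 (5.1)] [cite: McCallumLMS1991, §5 Lemma 5.1] -/
theorem invariant_selmer_trichotomy_of_depth_pos [NeZero (W.conductorNorm ℤ)]
    (hpos : 0 < W.Δ) (hs2 : W.HasSurjectiveModNGaloisRep 2) (hTam : Odd W.tamagawaProduct)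
    (h4 : Nat.card (W.selmerGroup 2) = 4 ∧ ∃ c ∈ (W.kummerSelmerStructure ((2 : ℕ) : ℤ)).selmerGroup,
      galoisCohomology.localization (W.torsionGaloisModule ((2 : ℕ) : ℤ)) (Sum.inl Rat.infinitePlace) 1 c ≠ 0)
    (hK : IsImaginaryQuadratic K) (hodd : Odd (discr K)) (hH : SatisfiesHeegnerHypothesis (W.conductorNorm ℤ) K)
    (h2K : ((Ideal.span {(2 : ℤ)}).primesOver (𝓞 K)).ncard = 2)
    {Wd : WeierstrassCurve ℚ} [Wd.IsElliptic] (Cd : VariableChange ℚ) (hCd : Cd • W.quadraticTwist (discr K : ℚ) = Wd)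
    (hDEF : padicValNat 2 Wd.tamagawaProduct = 0) {τ : K ≃ₐ[ℚ] K} (hτ1 : τ ≠ 1)
    (hrk : (W.baseChange K).mordellWeilRank = 1)
    (hr0 : W.analyticRank = 0) (hsq : ¬ IsSquare ((NumberField.discr K : ℚ) * W.Δ))
    (Dt : ModularParametrizationData W (W.conductorNorm ℤ)) (β : ℤ) (ι : K →+* ℂ) (d₁ : KolyvaginHeegnerData Dt β ι 1)
    {M₀ : ℕ} (hdiv : ∃ Q : (W.baseChange (ringClassField K ι 1)).toAffine.Point, ((2 ^ M₀ : ℕ) : ℤ) • Q = d₁.derivedPoint)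
    (hndiv : ¬ ∃ Q : (W.baseChange (ringClassField K ι 1)).toAffine.Point, ((2 ^ (M₀ + 1) : ℕ) : ℤ) • Q = d₁.derivedPoint) :
    ∃ (Q₀ : (W.baseChange K).toAffine.Point) (s_y : galH1Torsion W ((2 : ℕ) : ℤ)),
      ((2 ^ M₀ : ℕ) : ℤ) • Affine.Point.map (W' := W) (algebraMap K (ringClassField K ι 1)).toRatAlgHom Q₀ = d₁.derivedPoint ∧
      resTorsion W K ((2 : ℕ) : ℤ) s_y = kummerMapTorsion (W.baseChange K) ((2 : ℕ) : ℤ) (GenusKolyArch.hdiv_two_baseChange W K) Q₀ ∧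
      s_y ∈ W.selmerGroup ((2 : ℕ) : ℤ) ∧ s_y ≠ 0 ∧
      ∀ {m : galH1Torsion (W.baseChange K) ((2 : ℕ) : ℤ)}, m ∈ selmerGroup (W.baseChange K) ((2 : ℕ) : ℤ) →
        conjAct W τ ((2 : ℕ) : ℤ) m = m →
        ∃! s : galH1Torsion W ((2 : ℕ) : ℤ), resTorsion W K ((2 : ℕ) : ℤ) s = m ∧ s ∈ W.selmerGroup ((2 : ℕ) : ℤ) ∧
          (m ∈ (kummerMapTorsion (W.baseChange K) ((2 : ℕ) : ℤ) (GenusKolyArch.hdiv_two_baseChange W K)).range ↔ s = 0 ∨ s = s_y) := by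
  obtain ⟨P₀, Q₀, -, hP₀, hQ₀, hQ₀ndiv, ⟨s_y, ⟨hsy, hsySel⟩, -⟩, hne⟩ :=
    existsUnique_resTorsion_eq_kummer_of_depth_pos W K hpos hs2 hTam h4 hK hodd hH h2K Cd hCd hDEF hτ1 hr0 hsq Dt β ι d₁ hdiv hndiv
  refine ⟨Q₀, s_y, ?_, hsy, hsySel, hne s_y hsy, fun {m} hm hσm ↦ ?_⟩
  · rw [← hP₀, ← map_zsmul, hQ₀]
  · obtain ⟨s, ⟨hs, hsSel⟩, huniq⟩ := existsUnique_mem_selmerGroup_resTorsion_eq_of_kFourPos W K hpos hs2 hTam h4 hK hodd hH h2K Cd hCd hDEF hτ1 hm hσm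
    refine ⟨s, ⟨hs, hsSel, ?_⟩, fun s' hs' ↦ huniq s' ⟨hs'.1, hs'.2.1⟩⟩
    rw [← hs]
    exact resTorsion_mem_range_kummerMapTorsion_iff_of_kFourPos W K hs2 hK hrk hQ₀ndiv hsy s

end Summit.BirchSwinnertonDyer.BirchSwinnertonDyer.Theorems.GenusSupplyNarrow.KFourPosCell

end
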